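import Literature.MathematicalPhysics.QuantumManyBody.LHYIntegrandPerturbation
import Literature.MathematicalPhysics.QuantumManyBody.LHYLatticeSums
import Literature.MathematicalPhysics.QuantumManyBody.BoseEinsteinCondensation
import HarnessLib

/-!
# Replacing `τ(p)` by `p²` and `ĝ(p)` by `ĝ(0)` in the Bogoliubov sum (FGJMOT Lemma 8.1, first part) — toolkit

Topic `Literature/MathematicalPhysics/QuantumManyBody`, namespace `BoseGas` (provefact
`Literature.MathematicalPhysics.QuantumManyBody.BoseGas.Junge2026_neumannBox_pinnedLowerBound`; brick 18b:
[FournaisEtAl2024, Lemma 8.1, proof, first three displays]). This file adds the inputs of that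
computation not yet in `LHYIntegrandBounds.lean` / `LHYIntegrandPerturbation.lean` /
`LHYLatticeSums.lean`:

* `lhyG_eq_factor_of_ge`, `abs_lhyG_le_two_mul_abs_cube` — the zero-point function
  `G(t) = √(1+2t) - 1 - t + t²/2` for NEGATIVE arguments (the Fourier transform `ĝ(p)` is not
  signed at high momenta): `G = (s-1)³(s+3)/8`, `s = √(1+2t)`, for `t ≥ -½`, and `|G(t)| ≤ 2|t|³`
  for `|t| ≤ 3/8` ("Using that `G(t) ≤ Ct³`");
* `sum_inv_sup_pow_four_le` — the lattice tail `Σ_{|k|∞ ≥ N} |k|∞⁻⁴ ≤ 24/N` ("`Σ_{|p|>Kℓ⁻¹} p⁻⁴ ≤ Cℓ⁴K⁻¹`").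

No definitions.

## References

* [FournaisEtAl2024] S. Fournais et al., arXiv:2408.14222, Ann. Henri Poincaré (2026): Lemma 8.1 (proof).
-/

noncomputable section

open Finset
open scoped BigOperators

namespace Literature.MathematicalPhysics.QuantumManyBody.BoseGas

/-! ### `G` for arguments `t ≥ -½` -/

/-- **`G = (s-1)³(s+3)/8`**, `s = √(1+2t)`, for all `t ≥ -½`. [cite: FournaisEtAl2024, Lemma 8.1 (proof)] -/
theorem lhyG_eq_factor_of_ge {t : ℝ} (ht : -(1 / 2) ≤ t) :
    Real.sqrt (1 + 2 * t) - 1 - t + t ^ 2 / 2 =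
      (Real.sqrt (1 + 2 * t) - 1) ^ 3 * (Real.sqrt (1 + 2 * t) + 3) / 8 := by
  have hs2 : Real.sqrt (1 + 2 * t) ^ 2 = 1 + 2 * t := Real.sq_sqrt (by linarith)
  have htc : t = (Real.sqrt (1 + 2 * t) ^ 2 - 1) / 2 := by rw [hs2]; ring
  generalize Real.sqrt (1 + 2 * t) = s at hs2 htc ⊢
  rw [htc]; ring

/-- **`|G(t)| ≤ 2|t|³` for `|t| ≤ 3/8`** (then `s = √(1+2t) ∈ [½, 3/2]`, `|s - 1| = 2|t|/(s+1) ≤ (4/3)|t|`).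
[cite: FournaisEtAl2024, Lemma 8.1 (proof: "G(t) ≤ Ct³")] -/
theorem abs_lhyG_le_two_mul_abs_cube {t : ℝ} (ht : |t| ≤ 3 / 8) :
    |Real.sqrt (1 + 2 * t) - 1 - t + t ^ 2 / 2| ≤ 2 * |t| ^ 3 := by
  rw [abs_le] at ht
  rw [lhyG_eq_factor_of_ge (by linarith)]
  set s := Real.sqrt (1 + 2 * t) with hs
  have hs2 : s ^ 2 = 1 + 2 * t := Real.sq_sqrt (by linarith)
  have hs_lo : 1 / 2 ≤ s := by
    rw [hs, show (1 / 2 : ℝ) = Real.sqrt (1 / 4) by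
      rw [show (1 / 4 : ℝ) = (1 / 2) ^ 2 by norm_num, Real.sqrt_sq (by norm_num)]]
    exact Real.sqrt_le_sqrt (by linarith)
  have hs_hi : s ≤ 3 / 2 := by
    rw [hs, show (3 / 2 : ℝ) = Real.sqrt (9 / 4) by
      rw [show (9 / 4 : ℝ) = (3 / 2) ^ 2 by norm_num, Real.sqrt_sq (by norm_num)]]
    exact Real.sqrt_le_sqrt (by linarith)
  -- `|s - 1| ≤ (4/3)|t|`
  have hsm1 : |s - 1| ≤ 4 / 3 * |t| := by
    have h1 : (s - 1) * (s + 1) = 2 * t := by nlinarith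
    have hsp : 0 < s + 1 := by linarith
    have h2 : s - 1 = 2 * t / (s + 1) := by field_simp; linarith
    rw [h2, abs_div, abs_of_pos hsp, div_le_iff₀ hsp, abs_mul, abs_two]
    nlinarith [abs_nonneg t]
  have h3 : |(s - 1) ^ 3| ≤ (4 / 3 * |t|) ^ 3 := by
    rw [abs_pow]; exact pow_le_pow_left₀ (abs_nonneg _) hsm1 3
  rw [abs_div, abs_mul, abs_of_pos (by linarith : (0 : ℝ) < s + 3), abs_of_pos (by norm_num : (0 : ℝ) < 8)]
  calc |(s - 1) ^ 3| * (s + 3) / 8 ≤ (4 / 3 * |t|) ^ 3 * (9 / 2) / 8 := by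
        gcongr; linarith
    _ = 4 / 3 * |t| ^ 3 := by ring
    _ ≤ 2 * |t| ^ 3 := by nlinarith [pow_nonneg (abs_nonneg t) 3]

/-- **`|xG(y/x)| ≤ 2|y|³/x²`** for `x > 0`, `|y| ≤ 3x/8` (the tail bound with a possibly negative
`y = ρ_zĝ(p)`). [cite: FournaisEtAl2024, Lemma 8.1 (proof, second display)] -/
theorem abs_mul_lhyG_le {x y : ℝ} (hx : 0 < x) (hy : |y| ≤ 3 * x / 8) :
    |x * (Real.sqrt (1 + 2 * (y / x)) - 1 - y / x + (y / x) ^ 2 / 2)| ≤ 2 * |y| ^ 3 / x ^ 2 := by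
  have ht : |y / x| ≤ 3 / 8 := by
    rw [abs_div, abs_of_pos hx, div_le_iff₀ hx]; linarith
  rw [abs_mul, abs_of_pos hx]
  calc x * |Real.sqrt (1 + 2 * (y / x)) - 1 - y / x + (y / x) ^ 2 / 2| ≤ x * (2 * |y / x| ^ 3) :=
        mul_le_mul_of_nonneg_left (abs_lhyG_le_two_mul_abs_cube ht) hx.le
    _ = 2 * |y| ^ 3 / x ^ 2 := by rw [abs_div, abs_of_pos hx]; field_simp

/-! ### `∑ |k|∞⁻⁴` over `|k|∞ ≥ N` -/

/-- **`∑_{k ∈ u, |k|∞ ≥ N} |k|∞⁻⁴ ≤ 24/N`** (`N ≥ 1`, `u` finite): by shells,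
`≤ ∑_{j ≥ N} 3(j+1)²/j⁴ ≤ 12∑_{j ≥ N} j⁻² ≤ 24/N`. [cite: FournaisEtAl2024, Lemma 8.1 (proof: "Σ_{|p|>Kℓ⁻¹} p⁻⁴")] -/
theorem sum_inv_sup_pow_four_le {N : ℕ} (hN : 1 ≤ N) (u : Finset (Fin 3 → ℕ)) :
    ∑ k ∈ u.filter (fun k => N ≤ univ.sup k), (((univ.sup k : ℕ) : ℝ) ^ 4)⁻¹ ≤
      24 / (N : ℝ) := by
  set M := u.sup (fun k => univ.sup k) with hM
  set T := u.filter (fun k => N ≤ univ.sup k) with hT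
  have hN0 : (0 : ℝ) < N := by exact_mod_cast hN
  have hmaps : ∀ k ∈ T, univ.sup k ∈ Finset.Icc N M := fun k hk => by
    have h := mem_filter.1 hk
    exact mem_Icc.2 ⟨h.2, Finset.le_sup (f := fun k => univ.sup k) h.1⟩
  rw [← sum_fiberwise_of_maps_to hmaps]
  have hinner : ∀ j ∈ Finset.Icc N M,
      ∑ k ∈ T.filter (fun k => univ.sup k = j), (((univ.sup k : ℕ) : ℝ) ^ 4)⁻¹ ≤
        12 * ((j : ℝ) ^ 2)⁻¹ := by
    intro j hj
    have hjN : (N : ℝ) ≤ j := by exact_mod_cast (mem_Icc.1 hj).1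
    have hj1 : (1 : ℝ) ≤ j := le_trans (by exact_mod_cast hN) hjN
    have hj0 : (0 : ℝ) < j := by linarith
    calc ∑ k ∈ T.filter (fun k => univ.sup k = j), (((univ.sup k : ℕ) : ℝ) ^ 4)⁻¹
        = ∑ k ∈ T.filter (fun k => univ.sup k = j), (((j : ℕ) : ℝ) ^ 4)⁻¹ :=
          sum_congr rfl fun k hk => by rw [(mem_filter.1 hk).2]
      _ = ((T.filter fun k => univ.sup k = j).card : ℝ) * ((j : ℝ) ^ 4)⁻¹ := by
          rw [sum_const, nsmul_eq_mul]
      _ ≤ 3 * ((j : ℝ) + 1) ^ 2 * ((j : ℝ) ^ 4)⁻¹ := by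
          gcongr
          exact card_filter_sup_eq_le j T
      _ ≤ 12 * (j : ℝ) ^ 2 * ((j : ℝ) ^ 4)⁻¹ := by
          apply mul_le_mul_of_nonneg_right _ (by positivity)
          nlinarith
      _ = 12 * ((j : ℝ) ^ 2)⁻¹ := by field_simp
  calc ∑ j ∈ Finset.Icc N M, ∑ k ∈ T.filter (fun k => univ.sup k = j), (((univ.sup k : ℕ) : ℝ) ^ 4)⁻¹
      ≤ ∑ j ∈ Finset.Icc N M, 12 * ((j : ℝ) ^ 2)⁻¹ := sum_le_sum hinner
    _ = 12 * ∑ j ∈ Finset.Icc N M, ((j : ℝ) ^ 2)⁻¹ := by rw [mul_sum]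
    _ ≤ 12 * (2 / N) := mul_le_mul_of_nonneg_left (sum_Icc_inv_sq_le hN M) (by norm_num)
    _ = 24 / N := by ring

/-! ### The termwise replacement estimate -/

/-- **The termwise estimate of Lemma 8.1** (low momenta). Let `x = τ(p)` and `x' = p²` with
`x' /2 ≤ x`, `|x - x'| ≤ δ`, and `0 ≤ y, y₀ ≤ Y` (`y = ρ_zĝ(p)`, `y₀ = ρ_zĝ(0)`) with
`|y - y₀| ≤ εx'` (`ε = ρ_zR²ĝ(0)`, from `|ĝ(p) - ĝ(0)| ≤ R²ĝ(0)p²`). Then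
`|xG(y/x) - x'G(y₀/x')| ≤ 6Y²δ/x'² + 4Yε` — the two displays
"`|(τ - p²)G(ρ_zĝ/τ)| ≤ …`, `p²|G(ρ_zĝ/τ) - G(8πaρ_z/p²)| ≤ …`" combined.
[cite: FournaisEtAl2024, Lemma 8.1 (proof, third display)] -/
theorem abs_tauG_sub_sqG_le {x x' y y₀ Y δ ε : ℝ} (hx' : 0 < x') (hxx' : x' / 2 ≤ x)
    (hδ : |x - x'| ≤ δ) (hy : 0 ≤ y) (hyY : y ≤ Y) (hy₀ : 0 ≤ y₀) (hy₀Y : y₀ ≤ Y)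
    (hε : |y - y₀| ≤ ε * x') :
    |x * (Real.sqrt (1 + 2 * (y / x)) - 1 - y / x + (y / x) ^ 2 / 2) -
        x' * (Real.sqrt (1 + 2 * (y₀ / x')) - 1 - y₀ / x' + (y₀ / x') ^ 2 / 2)| ≤
      6 * Y ^ 2 * δ / x' ^ 2 + 4 * Y * ε := by
  have hx : 0 < x := by linarith
  have hY : 0 ≤ Y := hy.trans hyY
  have hδ0 : 0 ≤ δ := (abs_nonneg _).trans hδ
  have hε0 : 0 ≤ ε * x' := (abs_nonneg _).trans hε
  have hεnn : 0 ≤ ε := nonneg_of_mul_nonneg_left hε0 hx'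
  have h := abs_mul_lhyG_sub_mul_lhyG_le hx hx' hy hy₀
  -- `y/x ≤ 2Y/x'`, `y₀/x' ≤ Y/x' ≤ 2Y/x'`
  have h2x : 1 / x ≤ 2 / x' := by
    rw [div_le_div_iff₀ hx hx']; linarith
  have ht : y / x ≤ 2 * Y / x' := by
    calc y / x = y * (1 / x) := by ring
      _ ≤ Y * (2 / x') := mul_le_mul hyY h2x (by positivity) hY
      _ = 2 * Y / x' := by ring
  have ht' : y₀ / x' ≤ 2 * Y / x' := by
    rw [div_le_div_iff_of_pos_right hx']; linarith
  have ht0 : 0 ≤ y / x := by positivity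
  have ht'0 : 0 ≤ y₀ / x' := by positivity
  have hmax : max (y / x) (y₀ / x') ≤ 2 * Y / x' := max_le ht ht'
  -- `|y/x - y₀/x'| ≤ 2ε + 2Yδ/x'²`
  have hdiff : |y / x - y₀ / x'| ≤ 2 * ε + 2 * Y * δ / x' ^ 2 := by
    have hsplit : y / x - y₀ / x' = (y - y₀) / x + y₀ * (x' - x) / (x * x') := by
      field_simp; ring
    rw [hsplit]
    calc |(y - y₀) / x + y₀ * (x' - x) / (x * x')|
        ≤ |(y - y₀) / x| + |y₀ * (x' - x) / (x * x')| := abs_add_le _ _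
      _ = |y - y₀| * (1 / x) + y₀ * |x - x'| * (1 / (x * x')) := by
          rw [abs_div, abs_of_pos hx, abs_div, abs_mul, abs_of_nonneg hy₀,
            abs_of_pos (mul_pos hx hx'), abs_sub_comm x' x]
          ring
      _ ≤ ε * x' * (2 / x') + Y * δ * (2 / x' ^ 2) := by
          apply add_le_add
          · exact mul_le_mul hε h2x (by positivity) hε0
          · have h1 : 1 / (x * x') ≤ 2 / x' ^ 2 := by
              rw [div_le_div_iff₀ (by positivity) (by positivity)]; nlinarith
            exact mul_le_mul (mul_le_mul hy₀Y hδ (abs_nonneg _) hY) h1 (by positivity) (by positivity)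
      _ = 2 * ε + 2 * Y * δ / x' ^ 2 := by field_simp
  -- assemble
  calc |x * (Real.sqrt (1 + 2 * (y / x)) - 1 - y / x + (y / x) ^ 2 / 2) -
        x' * (Real.sqrt (1 + 2 * (y₀ / x')) - 1 - y₀ / x' + (y₀ / x') ^ 2 / 2)|
      ≤ |x - x'| * ((y / x) ^ 2 / 2) + x' * (max (y / x) (y₀ / x') * |y / x - y₀ / x'|) := h
    _ ≤ δ * ((2 * Y / x') ^ 2 / 2) + x' * ((2 * Y / x') * (2 * ε + 2 * Y * δ / x' ^ 2)) := by
        apply add_le_add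
        · exact mul_le_mul hδ (by gcongr) (by positivity) hδ0
        · exact mul_le_mul_of_nonneg_left (mul_le_mul hmax hdiff (abs_nonneg _) (by positivity)) hx'.le
    _ = 6 * Y ^ 2 * δ / x' ^ 2 + 4 * Y * ε := by field_simp; ring

/-! ### The high-momentum tail on the lattice -/

/-- `|k|∞ ≤ |k|₂` for a lattice point (as vectors of `ℝ³`). [folklore] -/
theorem sup_le_norm_toLp (k : Fin 3 → ℕ) :
    ((univ.sup k : ℕ) : ℝ) ≤ ‖(WithLp.toLp 2 (fun i => (k i : ℝ)) : Space)‖ := by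
  obtain ⟨i, _, hi⟩ := Finset.exists_mem_eq_sup (univ : Finset (Fin 3)) univ_nonempty k
  rw [hi]
  have h := PiLp.norm_apply_le (WithLp.toLp 2 (fun i => (k i : ℝ)) : Space) i
  simpa using h

/-- **The high-momentum tail of Lemma 8.1**: if `τ(k) ≥ (h|k|)²/2` and `|y(k)|, y₀ ≤ Y` with
`Y ≤ (3/16)(hN)²` (so that `|y/τ| ≤ 3/8` beyond `|k|∞ ≥ N ≥ 1`), then over any finite set of modes
with `|k|∞ ≥ N`,
`Σ (|τG(y/τ)| + (h|k|)²G(y₀/(h|k|)²)) ≤ 204·Y³/(h⁴N)` ("`≤ CK_ℓ^{3/4}(ρa)³Σ_{|p|>Kℓ⁻¹}p⁻⁴ ≤ Cℓ³(ρa)^{5/2}K_ℓ^{7/4}K⁻¹`").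
[cite: FournaisEtAl2024, Lemma 8.1 (proof, second display)] -/
theorem sum_high_tail_le {h Y y₀ : ℝ} (hh : 0 < h) (hY : 0 ≤ Y) (hy₀ : 0 ≤ y₀) (hy₀Y : y₀ ≤ Y)
    (τ y : (Fin 3 → ℕ) → ℝ) {N : ℕ} (hN : 1 ≤ N) (hsmall : Y ≤ 3 / 16 * (h * N) ^ 2)
    (hτ : ∀ k : Fin 3 → ℕ, N ≤ univ.sup k → (h * ‖(WithLp.toLp 2 (fun i => (k i : ℝ)) : Space)‖) ^ 2 / 2 ≤ τ k)
    (hy : ∀ k, |y k| ≤ Y) (u : Finset (Fin 3 → ℕ)) :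
    ∑ k ∈ u.filter (fun k => N ≤ univ.sup k),
        (|τ k * (Real.sqrt (1 + 2 * (y k / τ k)) - 1 - y k / τ k + (y k / τ k) ^ 2 / 2)| +
          (h * ‖(WithLp.toLp 2 (fun i => (k i : ℝ)) : Space)‖) ^ 2 *
            (Real.sqrt (1 + 2 * (y₀ / (h * ‖(WithLp.toLp 2 (fun i => (k i : ℝ)) : Space)‖) ^ 2)) - 1 -
              y₀ / (h * ‖(WithLp.toLp 2 (fun i => (k i : ℝ)) : Space)‖) ^ 2 +
              (y₀ / (h * ‖(WithLp.toLp 2 (fun i => (k i : ℝ)) : Space)‖) ^ 2) ^ 2 / 2)) ≤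
      204 * Y ^ 3 / (h ^ 4 * N) := by
  have hN0 : (0 : ℝ) < N := by exact_mod_cast hN
  -- termwise bound by `(17/2) Y³/(h⁴|k|∞⁴)`
  have hterm : ∀ k ∈ u.filter (fun k => N ≤ univ.sup k),
      |τ k * (Real.sqrt (1 + 2 * (y k / τ k)) - 1 - y k / τ k + (y k / τ k) ^ 2 / 2)| +
          (h * ‖(WithLp.toLp 2 (fun i => (k i : ℝ)) : Space)‖) ^ 2 *
            (Real.sqrt (1 + 2 * (y₀ / (h * ‖(WithLp.toLp 2 (fun i => (k i : ℝ)) : Space)‖) ^ 2)) - 1 -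
              y₀ / (h * ‖(WithLp.toLp 2 (fun i => (k i : ℝ)) : Space)‖) ^ 2 +
              (y₀ / (h * ‖(WithLp.toLp 2 (fun i => (k i : ℝ)) : Space)‖) ^ 2) ^ 2 / 2) ≤
        17 / 2 * Y ^ 3 / h ^ 4 * (((univ.sup k : ℕ) : ℝ) ^ 4)⁻¹ := by
    intro k hk
    have hkN : N ≤ univ.sup k := (mem_filter.1 hk).2
    set v : ℝ := ‖(WithLp.toLp 2 (fun i => (k i : ℝ)) : Space)‖ with hv
    set m : ℝ := ((univ.sup k : ℕ) : ℝ) with hm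
    have hmN : (N : ℝ) ≤ m := by rw [hm]; exact_mod_cast hkN
    have hm0 : 0 < m := hN0.trans_le hmN
    have hmv : m ≤ v := sup_le_norm_toLp k
    have hv0 : 0 < v := hm0.trans_le hmv
    set P2 : ℝ := (h * v) ^ 2 with hP2
    have hP2pos : 0 < P2 := by positivity
    have hP2N : (h * N) ^ 2 ≤ P2 := by
      rw [hP2]; exact pow_le_pow_left₀ (by positivity) (by nlinarith) 2
    have hτk : P2 / 2 ≤ τ k := hτ k hkN
    have hτ0 : 0 < τ k := by linarith
    -- first term: `|τG(y/τ)| ≤ 2|y|³/τ² ≤ 8Y³/P2²`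
    have h1 : |τ k * (Real.sqrt (1 + 2 * (y k / τ k)) - 1 - y k / τ k + (y k / τ k) ^ 2 / 2)| ≤
        8 * Y ^ 3 / P2 ^ 2 := by
      have hyk : |y k| ≤ 3 * τ k / 8 := by
        calc |y k| ≤ Y := hy k
          _ ≤ 3 / 16 * (h * N) ^ 2 := hsmall
          _ ≤ 3 / 16 * P2 := by gcongr
          _ ≤ 3 * τ k / 8 := by linarith
      calc |τ k * (Real.sqrt (1 + 2 * (y k / τ k)) - 1 - y k / τ k + (y k / τ k) ^ 2 / 2)|
          ≤ 2 * |y k| ^ 3 / τ k ^ 2 := abs_mul_lhyG_le hτ0 hyk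
        _ ≤ 2 * Y ^ 3 / (P2 / 2) ^ 2 := by
            have hnum : 2 * |y k| ^ 3 ≤ 2 * Y ^ 3 := by
              have := pow_le_pow_left₀ (abs_nonneg _) (hy k) 3
              linarith
            have hden : (P2 / 2) ^ 2 ≤ τ k ^ 2 := pow_le_pow_left₀ (by positivity) hτk 2
            exact div_le_div₀ (by positivity) hnum (by positivity) hden
        _ = 8 * Y ^ 3 / P2 ^ 2 := by field_simp; ring
    -- second term: `P2 G(y₀/P2) ≤ y₀³/(2P2²) ≤ Y³/(2P2²)`
    have h2 : P2 * (Real.sqrt (1 + 2 * (y₀ / P2)) - 1 - y₀ / P2 + (y₀ / P2) ^ 2 / 2) ≤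
        Y ^ 3 / (2 * P2 ^ 2) := by
      calc P2 * (Real.sqrt (1 + 2 * (y₀ / P2)) - 1 - y₀ / P2 + (y₀ / P2) ^ 2 / 2) ≤ y₀ ^ 3 / (2 * P2 ^ 2) :=
            (mul_lhyG_le hP2pos hy₀).2
        _ ≤ Y ^ 3 / (2 * P2 ^ 2) := by gcongr
    -- combine and pass to `|k|∞`
    have hP2m : (h * m) ^ 2 ≤ P2 := by rw [hP2]; exact pow_le_pow_left₀ (by positivity) (by nlinarith) 2
    have hP4 : (P2 ^ 2)⁻¹ ≤ (h ^ 4 * m ^ 4)⁻¹ := by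
      rw [inv_le_inv₀ (by positivity) (by positivity)]
      calc h ^ 4 * m ^ 4 = ((h * m) ^ 2) ^ 2 := by ring
        _ ≤ P2 ^ 2 := pow_le_pow_left₀ (by positivity) hP2m 2
    calc _ ≤ 8 * Y ^ 3 / P2 ^ 2 + Y ^ 3 / (2 * P2 ^ 2) := add_le_add h1 h2
      _ = 17 / 2 * Y ^ 3 * (P2 ^ 2)⁻¹ := by field_simp; ring
      _ ≤ 17 / 2 * Y ^ 3 * (h ^ 4 * m ^ 4)⁻¹ := mul_le_mul_of_nonneg_left hP4 (by positivity)
      _ = 17 / 2 * Y ^ 3 / h ^ 4 * (m ^ 4)⁻¹ := by field_simp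
  calc _ ≤ ∑ k ∈ u.filter (fun k => N ≤ univ.sup k), 17 / 2 * Y ^ 3 / h ^ 4 * (((univ.sup k : ℕ) : ℝ) ^ 4)⁻¹ :=
        sum_le_sum hterm
    _ = 17 / 2 * Y ^ 3 / h ^ 4 * ∑ k ∈ u.filter (fun k => N ≤ univ.sup k), (((univ.sup k : ℕ) : ℝ) ^ 4)⁻¹ := by
        rw [mul_sum]
    _ ≤ 17 / 2 * Y ^ 3 / h ^ 4 * (24 / N) :=
        mul_le_mul_of_nonneg_left (sum_inv_sup_pow_four_le hN u) (by positivity)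
    _ = 204 * Y ^ 3 / (h ^ 4 * N) := by field_simp; ring

end Literature.MathematicalPhysics.QuantumManyBody.BoseGas
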